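import Literature.MathematicalPhysics.QuantumFieldTheory.Balaban1983to89.Node00.TStepOfRecord
import Literature.MathematicalPhysics.QuantumFieldTheory.Balaban1983to89.Node00.RStepSlotOfRecord

/-!
# NODE 00 — DEFINER ₇b/₉ (T-side), FILE 2: THE REPRESENTED TOWER OF RECORD — `rep_0` = the one-term representation of `ρ₀`,
# `rep_{k+1} = Rstep (Tstep rep_k)`, the densities of record `ρ_k := eval rep_k` and `𝐓ρ_k := eval (Tstep rep_k)` as EXPLICIT
# functions, and the three faces `eval_zero` ∕ `isRT_T` ∕ `integral_step` of n23-a's `RGMachineCore.Tower`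

Seat `pub-ymgap-node00-def-T` (DEFINER ₇b/₉, director R48, chair R437 (1)–(2): *«`RepTower` per run (admissible sequences; χ-factors
PINNED from def-R's `chi217`; `TexpA` built inductively from the (2.21) T-step …; `eval` = `Step.Repr218.Holds` by construction);
densities of record `ρ_k := eval rep_k` — explicit, pointwise meaningful; `Tstep`∕`Rstep` act ON representations»*).  [III] =
[Balaban1988Convergent], [IV] = [Balaban1989LargeFieldI].

WHAT THIS FILE IS.  The instantiation of FILE 1's slot recursion `texpAOfRecord E w R` (level 0 = `ρ₀` on every length-0 sequence,
level k+1 = `R`-step ∘ T-step (†)) at THE R-STEP OF RECORD `R := rstepSlotOfRecord F N ν τ ppSel` (def-R's FILE 8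
`Node00.RStepSlotOfRecord`: [IV] (0.3) acting on the `𝐓e^A` slot, selector `ppSel` residual per A7, fibre bond sets `fibOfSeq`):
* the POST-𝐑 slot family `slotsOfRecord` (its level-k slice is `rep_k`, def-R's `repr218OfRecord`) and the PRE-𝐑 family
  `slotsTOfRecord` (`0 ↦ start`, `k+1 ↦` the T-step (†) of level k; its level-(k+1) slice is `Tstep rep_k`; it is the family def-R's
  (R3) pin `repOfRecordAE` is fed);
* the DENSITIES OF RECORD `rhoOfRecord9 p g k := eval rep_k = Σ_s χ_k(s)·slot_k(s)` and `trhoOfRecord9 p g k := eval (Tstep rep_k)`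
  — explicit functions of the field (`densityOfRepr`), (2.18) holding for them BY CONSTRUCTION (`holds_…`);
* the kernel identities `rep_{k+1} = Rstep (Tstep rep_k)` (`repOfRecord9_succ`, node00-def's skeleton field `step`, `rfl`),
  `ρ_{k+1} = ` slice density of the R-stepped pre-𝐑 slot (`rfl`), (0.3) of the pre-𝐑 tower of record `= ρ_{k+1}`, `R` of record (v1.1)
  maps every density a.e.-equal to `𝐓ρ_k` to `ρ_{k+1}` (def-R's identities at this slot family);
* THE THREE FACES of the represented tower (n23-a `RGMachineCore.Tower.rho_zero ∕ isRT_Trho ∕ integral_succ`, node00-def's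
  `RepMachine.eval_zero ∕ isRT_T ∕ integral_step`): `rhoOfRecord9_zero` (PROVED, FILE 1 `χ_0 ≡ 1`), `isRT_trhoOfRecord9` (PROVED from
  the DISPLAYED step provisos `TStepProvisos` = unity law of the step weights + measurability + integrability, `k < K`; FILE 1
  `isRT_tstepOfRecord`), `integral_rhoOfRecord9_succ` (def-R's (0.4) under the displayed `RepData.Provisos` of [IV] p. 176);
  `intPiece_zero` discharges the level-0 integrability proviso (`ρ₀` = `e^{−E}`·Wilson–Boltzmann weight).
  INSTANCE CONVENTION (TS-8, dag-n11-a): the three def-R-facing statements (`rop_towerRepOfRecord_slotsT`,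
  `ROp03AEOfRecord_eq_rhoOfRecord9_succ`, `integral_rhoOfRecord9_succ`) are INSTANCE-GENERIC in `DecidableEq (PBond (F.P p.K) (k+1))`
  (an explicit binder; the proviso ∕ `rop` is read with the consumer's instance — def-R's cone synthesises the classical one, the
  `Record5` cone the global `instDecidableEqPBond`); the proofs bridge to def-R's classical-instance statements by `Subsingleton.elim` on
  the instance (`convert`).

* §4 — HOW A HAND PINS THE RESIDUAL `w` (dag-n22-b ■: the design-independent remainder): step weights RESUMMED along an index map
  from a labelled decomposition of unity (`resumWeights σ ω`, `stepWeightsOfResum`; labels = print's tuples `(P,Q,R,S)_{k+1}`, index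
  map = (3.5)∕(3.20)), with `isStepUnity_resumWeights` (`Finset.sum_fiberwise_of_maps_to`), `abs_resumWeights_le_one`,
  `measurable_resumWeights` discharging the provisos `unity` ∕ `absW_le` ∕ `measW` from label-level facts; `not_isStepUnity_zero`
  records that the unity law EXCLUDES the zero weights (the step's non-degeneracy clause; no junk inhabitant).

HONEST SCOPE.  Definitions of record + kernel bookkeeping; the two analytic faces are PROVED from DISPLAYED hypotheses, never assumed as
fields; residual data: `E` (the constant of `ρ₀` per run), the step weights `w` (law displayed), the selector `ppSel` (A7).  Nothing of
Bałaban's estimates asserted; Theorems 1–2 [III] ∕ the shape laws (2.19)–(2.44) ∕ (1.1)–(1.2) [IV] NOT asserted; counts unmoved by this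
file; nothing continuum ∕ ℝ⁴ ∕ OS ∕ mass-gap ∕ Clay.  No `sorry`, no `axiom`, no `opaque`, no `instance`, no `notation`.
-/

noncomputable section

open MeasureTheory
open scoped BigOperators

namespace Literature.MathematicalPhysics.QuantumFieldTheory.Balaban1983to89.Node00

open T4Continuum B14.Eq218Concrete

variable (F : T4Family) (N : ℕ) [NeZero N]

section Tower

variable (ν : Stage7Numerics) (τ : TowerNumerics)

/-! ## §1 The slot families, the representations `rep_k` ∕ `Tstep rep_k`, the densities of record -/

/-- **THE POST-𝐑 SLOT FAMILY OF RECORD**: FILE 1's recursion at the R-step of record — level 0 = `ρ₀` on every length-0 sequence,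
level k+1 = `rstepSlotOfRecord` of the T-step (†) of level k. [cite: Balaban1988Convergent, (2.18) p.257, (3.24) p.270; Balaban1989LargeFieldI, (0.3) p.176] -/
def slotsOfRecord (E : B12.RunParams → ℝ) (w : StepWeightsOfRecord F N ν τ.M) (ppSel : PpSelOfRecord F ν τ.M) :
    TexpAOfRecord F N ν τ.M :=
  texpAOfRecord F N ν τ.M E w (rstepSlotOfRecord F N ν τ ppSel)

/-- **THE PRE-𝐑 SLOT FAMILY OF RECORD**: level 0 = the start (`ρ₀`), level k+1 = the T-step (†) of the post-𝐑 level k (the slots of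
`𝐓ρ_k`; the family def-R's (R3) pin `repOfRecordAE` is fed). [cite: Balaban1988Convergent, (3.24)–(3.25) p.270; Balaban1989LargeFieldI, (0.2) p.176] -/
def slotsTOfRecord (E : B12.RunParams → ℝ) (w : StepWeightsOfRecord F N ν τ.M) (ppSel : PpSelOfRecord F ν τ.M) :
    TexpAOfRecord F N ν τ.M
  | p, g, 0 => slotsOfRecord F N ν τ E w ppSel p g 0
  | p, g, k + 1 => texpATOfRecord F N ν τ.M E w (rstepSlotOfRecord F N ν τ ppSel) p g k

/-- **`rep_k`** — the (2.18) representation of record after `k` steps (post-𝐑): def-R's slice of the post-𝐑 slot family.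
[cite: Balaban1988Convergent, (2.18) p.257; Balaban1989LargeFieldI, (0.3) p.176] -/
def repOfRecord9 (E : B12.RunParams → ℝ) (w : StepWeightsOfRecord F N ν τ.M) (ppSel : PpSelOfRecord F ν τ.M)
    (p : B12.RunParams) (g : ℕ → ℝ) (k : ℕ) : Step.Repr218 (F.P p.K) (SU N) k :=
  repr218OfRecord F N ν τ.M (slotsOfRecord F N ν τ E w ppSel) p g k

/-- **`Tstep rep_k`** — the (2.18) representation at level k+1 BEFORE the R-step: the slice of the pre-𝐑 slot family.
[cite: Balaban1988Convergent, (3.25) p.270, (2.18) p.257] -/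
def repTOfRecord9 (E : B12.RunParams → ℝ) (w : StepWeightsOfRecord F N ν τ.M) (ppSel : PpSelOfRecord F ν τ.M)
    (p : B12.RunParams) (g : ℕ → ℝ) (k : ℕ) : Step.Repr218 (F.P p.K) (SU N) (k + 1) :=
  repr218OfRecord F N ν τ.M (slotsTOfRecord F N ν τ E w ppSel) p g (k + 1)

/-- **`ρ_k := eval rep_k`** — THE DENSITY OF RECORD after `k` steps, an explicit function of the field: `Σ_s χ_k(s)·slot_k(s)`.
[cite: Balaban1988Convergent, (2.18) p.257; Balaban1989LargeFieldI, (0.2) p.176] -/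
def rhoOfRecord9 (E : B12.RunParams → ℝ) (w : StepWeightsOfRecord F N ν τ.M) (ppSel : PpSelOfRecord F ν τ.M)
    (p : B12.RunParams) (g : ℕ → ℝ) (k : ℕ) : Density (F.P p.K) k (SU N) :=
  densityOfRepr F N ν τ.M (slotsOfRecord F N ν τ E w ppSel) p g k

/-- **`𝐓ρ_k := eval (Tstep rep_k)`** — the T-stepped density of record at level k+1, an explicit function of the field.
[cite: Balaban1988Convergent, (3.1) p.264, (3.25) p.270] -/
def trhoOfRecord9 (E : B12.RunParams → ℝ) (w : StepWeightsOfRecord F N ν τ.M) (ppSel : PpSelOfRecord F ν τ.M)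
    (p : B12.RunParams) (g : ℕ → ℝ) (k : ℕ) : Density (F.P p.K) (k + 1) (SU N) :=
  densityOfRepr F N ν τ.M (slotsTOfRecord F N ν τ E w ppSel) p g (k + 1)

/-- (2.18) holds for `ρ_k` with `rep_k`, BY CONSTRUCTION (`eval = Step.Repr218.Holds`). [cite: Balaban1988Convergent, (2.18) p.257 (bookkeeping)] -/
theorem holds_repOfRecord9 (E : B12.RunParams → ℝ) (w : StepWeightsOfRecord F N ν τ.M) (ppSel : PpSelOfRecord F ν τ.M)
    (p : B12.RunParams) (g : ℕ → ℝ) (k : ℕ) :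
    (repOfRecord9 F N ν τ E w ppSel p g k).Holds (rhoOfRecord9 F N ν τ E w ppSel p g k) :=
  holds_densityOfRepr F N ν τ.M _ p g k

/-- (2.18) holds for `𝐓ρ_k` with `Tstep rep_k`, BY CONSTRUCTION. [cite: Balaban1988Convergent, (3.25) p.270 (bookkeeping)] -/
theorem holds_repTOfRecord9 (E : B12.RunParams → ℝ) (w : StepWeightsOfRecord F N ν τ.M) (ppSel : PpSelOfRecord F ν τ.M)
    (p : B12.RunParams) (g : ℕ → ℝ) (k : ℕ) :
    (repTOfRecord9 F N ν τ E w ppSel p g k).Holds (trhoOfRecord9 F N ν τ E w ppSel p g k) :=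
  holds_densityOfRepr F N ν τ.M _ p g (k + 1)

/-! ## §2 The kernel identities of the recursion -/

/-- The pre-𝐑 slot at level k+1 is the T-step (†) of the post-𝐑 slot at level k (`rfl`). [cite: Balaban1988Convergent, (3.24) p.270 (bookkeeping)] -/
theorem slotsTOfRecord_succ (E : B12.RunParams → ℝ) (w : StepWeightsOfRecord F N ν τ.M) (ppSel : PpSelOfRecord F ν τ.M)
    (p : B12.RunParams) (g : ℕ → ℝ) (k : ℕ) :
    slotsTOfRecord F N ν τ E w ppSel p g (k + 1)
      = tstepOfRecord F N ν τ.M w p g k (slotsOfRecord F N ν τ E w ppSel p g k) := rfl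

/-- The post-𝐑 slot at level k+1 is the R-step of record of the pre-𝐑 slot (`rfl`). [cite: Balaban1989LargeFieldI, (0.3) p.176 (bookkeeping)] -/
theorem slotsOfRecord_succ (E : B12.RunParams → ℝ) (w : StepWeightsOfRecord F N ν τ.M) (ppSel : PpSelOfRecord F ν τ.M)
    (p : B12.RunParams) (g : ℕ → ℝ) (k : ℕ) :
    slotsOfRecord F N ν τ E w ppSel p g (k + 1)
      = rstepSlotOfRecord F N ν τ ppSel p g (k + 1) (slotsTOfRecord F N ν τ E w ppSel p g (k + 1)) := rfl

/-- At level 0 both families are the start `ρ₀`. [cite: Balaban1988Convergent, Thm 1 p.262 (bookkeeping)] -/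
theorem slotsTOfRecord_zero (E : B12.RunParams → ℝ) (w : StepWeightsOfRecord F N ν τ.M) (ppSel : PpSelOfRecord F ν τ.M)
    (p : B12.RunParams) (g : ℕ → ℝ) (s : SeqOfRecord F ν τ.M g p.K 0) :
    slotsTOfRecord F N ν τ E w ppSel p g 0 s = rhoZeroOfRecord F N p.K (g 0) (E p) := rfl

/-- **`rep_{k+1} = Rstep (Tstep rep_k)`** (node00-def's skeleton field `step`; chair R437 (2)), `rfl`: the level-(k+1) representation of
record IS def-R's R-stepped representation `rstepOfRecord` of the pre-𝐑 family. [cite: Balaban1989LargeFieldI, (0.3) p.176; Balaban1988Convergent, Theorem 1 p.262 («has again the form (2.18)»)] -/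
theorem repOfRecord9_succ (E : B12.RunParams → ℝ) (w : StepWeightsOfRecord F N ν τ.M) (ppSel : PpSelOfRecord F ν τ.M)
    (p : B12.RunParams) (g : ℕ → ℝ) (k : ℕ) :
    repOfRecord9 F N ν τ E w ppSel p g (k + 1) = rstepOfRecord F N ν τ (slotsTOfRecord F N ν τ E w ppSel) ppSel p g (k + 1) :=
  rfl

/-- **`ρ_0 = ρ₀`** (`eval_zero` ∕ n23-a's `rho_zero`): one term, `χ_0 ≡ 1` (FILE 1). [cite: Balaban1988Convergent, Thm 1 p.262, (2.18) p.257] -/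
theorem rhoOfRecord9_zero (E : B12.RunParams → ℝ) (w : StepWeightsOfRecord F N ν τ.M) (ppSel : PpSelOfRecord F ν τ.M)
    (p : B12.RunParams) (g : ℕ → ℝ) :
    rhoOfRecord9 F N ν τ E w ppSel p g 0 = rhoZeroOfRecord F N p.K (g 0) (E p) :=
  densityOfRepr_texpAOfRecord_zero F N ν τ.M E w _ p g

/-- **`ρ_{k+1}` is the slice density of the R-stepped pre-𝐑 slot** (`rfl`). [cite: Balaban1989LargeFieldI, (0.3) p.176 (bookkeeping)] -/
theorem rhoOfRecord9_succ (E : B12.RunParams → ℝ) (w : StepWeightsOfRecord F N ν τ.M) (ppSel : PpSelOfRecord F ν τ.M)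
    (p : B12.RunParams) (g : ℕ → ℝ) (k : ℕ) :
    rhoOfRecord9 F N ν τ E w ppSel p g (k + 1)
      = densityOfSlice F N ν τ.M p g (k + 1)
          (rstepSlotOfRecord F N ν τ ppSel p g (k + 1) (slotsTOfRecord F N ν τ E w ppSel p g (k + 1))) := rfl

/-- `𝐓ρ_k` is the slice density of the pre-𝐑 slot, i.e. `Σ_{s'} χ_{k+1}(s')·(†)(s')` (`rfl`). [cite: Balaban1988Convergent, (3.25) p.270 (bookkeeping)] -/
theorem trhoOfRecord9_eq (E : B12.RunParams → ℝ) (w : StepWeightsOfRecord F N ν τ.M) (ppSel : PpSelOfRecord F ν τ.M)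
    (p : B12.RunParams) (g : ℕ → ℝ) (k : ℕ) :
    trhoOfRecord9 F N ν τ E w ppSel p g k
      = fun V' => ∑ s', chiSeqOfRecord F N ν τ.M g p.K (k + 1) s' V'
          * tstepOfRecord F N ν τ.M w p g k (slotsOfRecord F N ν τ E w ppSel p g k) s' V' := rfl

/-- **(0.3) of the pre-𝐑 tower of record at level k+1 IS `ρ_{k+1}`** (def-R's kernel identity `rop_towerRepOfRecord_eq_densityOfSlice` at
the pre-𝐑 family).  INSTANCE-GENERIC (TS-8, dag-n11-a l.10453): stated for EVERY `DecidableEq (PBond …)` instance the consumer's context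
carries (def-R's cone synthesises the classical one, the `Record5` cone the global `instDecidableEqPBond`); the bridge to def-R's
classical-instance statement is `Subsingleton.elim` on the instance (`convert`). [cite: Balaban1989LargeFieldI, (0.3) p.176] -/
theorem rop_towerRepOfRecord_slotsT (E : B12.RunParams → ℝ) (w : StepWeightsOfRecord F N ν τ.M) (ppSel : PpSelOfRecord F ν τ.M)
    (p : B12.RunParams) (g : ℕ → ℝ) (k : ℕ) [DecidableEq (PBond (F.P p.K) (k + 1))] :
    (towerRepOfRecord F N ν τ (slotsTOfRecord F N ν τ E w ppSel) ppSel p g (k + 1)).toRepData.rop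
      = rhoOfRecord9 F N ν τ E w ppSel p g (k + 1) := by
  rw [rhoOfRecord9_succ]
  convert rop_towerRepOfRecord_eq_densityOfSlice F N ν τ _ ppSel p g (k + 1)

/-- **`R` of record (v1.1) maps `𝐓ρ_k` — and every density a.e.-equal to it — to `ρ_{k+1}`**, under the provisos of [IV] p. 176 (def-R's
`ROp03AEOfRecord_repOfRecordAE_eq_densityOfSlice` at the pre-𝐑 family).  INSTANCE-GENERIC in `DecidableEq (PBond …)` (TS-8; the proviso
hypothesis is read with the consumer's instance). [cite: Balaban1989LargeFieldI, (0.3)–(0.4) p.176; Balaban1988Convergent, Theorem 1 p.262] -/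
theorem ROp03AEOfRecord_eq_rhoOfRecord9_succ (E : B12.RunParams → ℝ) (w : StepWeightsOfRecord F N ν τ.M)
    (ppSel : PpSelOfRecord F ν τ.M) (gsel : B12.RunParams → ℕ → ℝ) (p : B12.RunParams) (k : ℕ)
    [DecidableEq (PBond (F.P p.K) (k + 1))] {ρ : Density (F.P p.K) (k + 1) (SU N)}
    (hae : (towerOfRecord F N ν τ (slotsTOfRecord F N ν τ E w ppSel) ppSel gsel p k).toRepData.total
      =ᵐ[fieldMeasure (F.P p.K) (k + 1) (SU N)] ρ)
    (hprov : (towerOfRecord F N ν τ (slotsTOfRecord F N ν τ E w ppSel) ppSel gsel p k).toRepData.Provisos) :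
    ROp03AEOfRecord F N (repOfRecordAE F N ν τ (slotsTOfRecord F N ν τ E w ppSel) ppSel gsel) p k ρ
      = rhoOfRecord9 F N ν τ E w ppSel p (gsel p) (k + 1) := by
  rw [rhoOfRecord9_succ]
  exact ROp03AEOfRecord_repOfRecordAE_eq_densityOfSlice F N ν τ _ ppSel gsel p k hae (by convert hprov)

/-! ## §3 The three faces of the represented tower -/

/-- **THE DISPLAYED STEP PROVISOS** at run `p`, couplings `g`, step `k` (hypotheses of `isRT_T`, never fields of the objects): the
level-k pieces `χ_k(s)·slot_k(s)` are integrable, the step weights `w p g k s'` are jointly measurable with `|w| ≤ 1`, the new front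
factors `χ_{k+1}(s')` are measurable, and the step weights resolve unity against them on the graph (`IsStepUnity`, [III] (3.2)–(3.9),
(3.16), (3.20)). [cite: Balaban1988Convergent, (3.2)–(3.3) p.265, (3.6)–(3.9) pp.265–266, (3.16) p.268] -/
structure TStepProvisos (E : B12.RunParams → ℝ) (w : StepWeightsOfRecord F N ν τ.M) (ppSel : PpSelOfRecord F ν τ.M)
    (p : B12.RunParams) (g : ℕ → ℝ) (k : ℕ) : Prop where
  /-- the level-k pieces `χ_k(s)·slot_k(s)` of `ρ_k` are integrable -/
  intPiece : ∀ s, Integrable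
    (fun U => chiSeqOfRecord F N ν τ.M g p.K k s U * slotsOfRecord F N ν τ E w ppSel p g k s U)
    (fieldMeasure (F.P p.K) k (SU N))
  /-- the step weights are jointly measurable in `(V', U)` -/
  measW : ∀ s', Measurable
    (fun z : GaugeField (F.P p.K) (k + 1) (SU N) × GaugeField (F.P p.K) k (SU N) => w p g k s' z.2 z.1)
  /-- the step weights are bounded by `1` -/
  absW_le : ∀ s' U V', |w p g k s' U V'| ≤ 1
  /-- the new front factors `χ_{k+1}(s')` are measurable -/
  measChi : ∀ s', Measurable (chiSeqOfRecord F N ν τ.M g p.K (k + 1) s')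
  /-- the unity law of the step weights against the new front factors, on the graph, `χ_k`-weighted -/
  unity : IsStepUnity (avOfRecord F N p.K k).avg (chiSeqOfRecord F N ν τ.M g p.K k)
    (chiSeqOfRecord F N ν τ.M g p.K (k + 1)) (w p g k)

/-- **`isRT_T`** (n23-a's `isRT_Trho`, node00-def's `RepMachine.isRT_T`): `𝐓ρ_k` of record IS an `IsRT`-image of `ρ_k` of record along
the averaging of record, for every `k < K`, under the displayed step provisos — PROVED (FILE 1 `isRT_tstepOfRecord`).
[cite: Balaban1988Convergent, (3.1) p.264, (3.25) p.270] -/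
theorem isRT_trhoOfRecord9 (E : B12.RunParams → ℝ) (w : StepWeightsOfRecord F N ν τ.M) (ppSel : PpSelOfRecord F ν τ.M)
    (p : B12.RunParams) (g : ℕ → ℝ) (k : ℕ) (hk : k < p.K) (h : TStepProvisos F N ν τ E w ppSel p g k) :
    IsRT (avOfRecord F N p.K k).avg (rhoOfRecord9 F N ν τ E w ppSel p g k) (trhoOfRecord9 F N ν τ E w ppSel p g k) :=
  isRT_tstepOfRecord F N ν τ.M w p g k hk _ h.intPiece h.measW h.absW_le h.measChi h.unity

/-- **`integral_step`** (n23-a's `integral_succ`, node00-def's `RepMachine.integral_step`; [IV] (0.4)): `∫ ρ_{k+1} = ∫ 𝐓ρ_k` under the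
displayed `RepData.Provisos` of the pre-𝐑 tower of record at level k+1 (def-R's `integral_densityOfSlice_rstepSlotOfRecord`, whose one
analytic input is b01's PROVED fibre lemma).  INSTANCE-GENERIC in `DecidableEq (PBond …)` (TS-8; the proviso hypothesis is read with the
consumer's instance, bridged to def-R's classical-instance statement by `Subsingleton.elim`). [cite: Balaban1989LargeFieldI, (0.4) p.176] -/
theorem integral_rhoOfRecord9_succ (E : B12.RunParams → ℝ) (w : StepWeightsOfRecord F N ν τ.M) (ppSel : PpSelOfRecord F ν τ.M)
    (p : B12.RunParams) (g : ℕ → ℝ) (k : ℕ) [DecidableEq (PBond (F.P p.K) (k + 1))]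
    (hprov : (towerRepOfRecord F N ν τ (slotsTOfRecord F N ν τ E w ppSel) ppSel p g (k + 1)).toRepData.Provisos) :
    ∫ V, rhoOfRecord9 F N ν τ E w ppSel p g (k + 1) V ∂(fieldMeasure (F.P p.K) (k + 1) (SU N))
      = ∫ V, trhoOfRecord9 F N ν τ E w ppSel p g k V ∂(fieldMeasure (F.P p.K) (k + 1) (SU N)) := by
  rw [rhoOfRecord9_succ]
  exact integral_densityOfSlice_rstepSlotOfRecord F N ν τ _ ppSel p g (k + 1) (by convert hprov)

/-- The pieces of `𝐓ρ_k` are integrable under the step provisos at `k < K` (FILE 1 `integrable_piece_texpASucc`) — the T-half of the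
next level's integrability proviso (the R-half is def-R's `RepData.Provisos`). [cite: Balaban1988Convergent, (3.25) p.270 (bookkeeping)] -/
theorem integrable_piece_trhoOfRecord9 (E : B12.RunParams → ℝ) (w : StepWeightsOfRecord F N ν τ.M) (ppSel : PpSelOfRecord F ν τ.M)
    (p : B12.RunParams) (g : ℕ → ℝ) (k : ℕ) (hk : k < p.K) (h : TStepProvisos F N ν τ E w ppSel p g k)
    (s' : SeqOfRecord F ν τ.M g p.K (k + 1)) :
    Integrable (fun V' => chiSeqOfRecord F N ν τ.M g p.K (k + 1) s' V' * slotsTOfRecord F N ν τ E w ppSel p g (k + 1) s' V')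
      (fieldMeasure (F.P p.K) (k + 1) (SU N)) :=
  integrable_piece_texpASucc (avOfRecord_measurable F N p.K k) (avOfRecord_haarAC F N p.K k hk) _ _ _ (w p g k) s'
    (h.intPiece s'.init) (h.measW s') (h.absW_le s') (h.measChi s')
    (fun V' => abs_chiSeqOfRecord_le_one F N ν τ.M g p.K (k + 1) s' V')

/-- **The level-0 integrability proviso HOLDS** (base case of `TStepProvisos.intPiece`): `χ_0 ≡ 1` (FILE 1 `chiSeqOfRecord_zero`) and
`ρ₀ = e^{−E}·`(the tree's Wilson–Boltzmann weight at `β = g₀⁻²`) is integrable (`Missing.integrable_boltzmann`).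
[cite: Balaban1988Convergent, Thm 1 p.262 (bookkeeping)] -/
theorem intPiece_zero (E : B12.RunParams → ℝ) (w : StepWeightsOfRecord F N ν τ.M) (ppSel : PpSelOfRecord F ν τ.M)
    (p : B12.RunParams) (g : ℕ → ℝ) (s : SeqOfRecord F ν τ.M g p.K 0) :
    Integrable (fun U => chiSeqOfRecord F N ν τ.M g p.K 0 s U * slotsOfRecord F N ν τ E w ppSel p g 0 s U)
      (fieldMeasure (F.P p.K) 0 (SU N)) := by
  have h : (fun U => chiSeqOfRecord F N ν τ.M g p.K 0 s U * slotsOfRecord F N ν τ E w ppSel p g 0 s U)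
      = fun U => Real.exp (-E p) * Missing.boltzmann (F.P p.K) ((g 0)⁻¹ ^ 2) U := by
    funext U
    rw [chiSeqOfRecord_zero, one_mul]
    rfl
  rw [h]
  exact (Missing.integrable_boltzmann RegularGaugeGroup.measurable_reTr (F.P p.K) (sq_nonneg _)).const_mul _

end Tower

/-! ## §4 Discharging the step provisos `unity` ∕ `absW_le` ∕ `measW`: step weights RESUMMED from a labelled decomposition of unity

How a hand pins the residual `w` (the design-independent remainder named by dag-n22-b ■ l.10260): give, per old sequence `s`, finitely
many LABELS `t` (print: the tuples `(P_{k+1}, Q_{k+1}, R_{k+1}, S_{k+1})` of (3.2)·(3.3)·(3.16)·(3.20)), an INDEX MAP `σ s t` = the new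
sequence `s` extended by `(Ω_{k+1}, Λ_{k+1})(t)` ((3.5), (3.20); `(σ s t).init = s`), and LABEL WEIGHTS `ω s t (U, V')` = the
decomposition factors other than the front factor `χ_{k+1}(σ s t)(V')`; the step weight of `s'` is the sum of `ω (init s') t` over the
labels mapped to `s'` (`Finset.sum_fiberwise`).  Unity of the labelled decomposition (on the graph, `χ_k`-weighted) gives
`IsStepUnity`; `Σ_t |ω s t| ≤ 1` (mutually exclusive `{0,1}`-products) gives `|w| ≤ 1`; measurable factors give `measW`.  The label
type is ONE finite type per `(p, g, k)` (e.g. quadruples of finite sets of `𝐃_{k+1}`-cube indices of record); a label whose domains are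
not admissible after `s` (r11's `Chain21`: `Λ_{k+1} ⊆ Ω_{k+1} ⊆ Λ_k`, both in `𝐃_{k+1}`) is sent by `σ s` to `s.snoc (∅, ∅)` (n22-b's
`Seq.snoc`, `Seq.init_snoc`) with label weight `0` — print's sums range over the admissible labels only. -/

section Resum

variable {P : Params} {G : Type*} {α : Type*} {D : ℕ → Set (Set α)} {k : ℕ} {Lb : Type*} [Fintype Lb]

omit [Fintype Lb] in
/-- **Junk exclusion of record for the T-step** (director LINE №31, ZEROCHART v0.33 — T-step side): the ZERO step weights violate the
displayed unity law at every `(s, U)` with `χ_k(s)(U) ≠ 0`; `IsStepUnity` is the step's non-degeneracy clause, so no `w ≡ 0` junk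
inhabits `TStepProvisos`. [cite: Balaban1988Convergent, (3.2)–(3.3) p.265 (bookkeeping)] -/
theorem not_isStepUnity_zero [GaugeGroup G] [Finite α] (avg : GaugeField P k G → GaugeField P (k + 1) G)
    (χk : Seq D k → Density P k G) (χk1 : Seq D (k + 1) → Density P (k + 1) G) {s : Seq D k} {U : GaugeField P k G}
    (h : χk s U ≠ 0) : ¬ IsStepUnity avg χk χk1 (fun _ _ _ => 0) := by
  intro hu
  have h1 := hu s U
  simp only [mul_zero, Finset.sum_const_zero] at h1
  exact h h1.symm

open Classical in
/-- **STEP WEIGHTS RESUMMED ALONG AN INDEX MAP**: `w(s')(U,V') := Σ_{t : σ (init s') t = s'} ω (init s') t (U,V')`.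
[cite: Balaban1988Convergent, (3.2)–(3.3) p.265, (3.5) p.265, (3.16) p.268, (3.20) p.269] -/
def resumWeights (σ : Seq D k → Lb → Seq D (k + 1))
    (ω : Seq D k → Lb → GaugeField P k G → GaugeField P (k + 1) G → ℝ) (s' : Seq D (k + 1)) (U : GaugeField P k G)
    (V' : GaugeField P (k + 1) G) : ℝ :=
  ∑ t ∈ Finset.univ.filter (fun t : Lb => σ s'.init t = s'), ω s'.init t U V'

open Classical in
/-- **Unity of the labelled decomposition ⇒ the unity law of the resummed step weights** (`Finset.sum_fiberwise_of_maps_to` over the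
index map; the front factors `χ_{k+1}(σ s t)` are matched label by label). [cite: Balaban1988Convergent, (3.2)–(3.3) p.265, (3.6)–(3.9) pp.265–266, (3.16) p.268] -/
theorem isStepUnity_resumWeights [GaugeGroup G] [Finite α] (avg : GaugeField P k G → GaugeField P (k + 1) G)
    (χk : Seq D k → Density P k G)
    (χk1 : Seq D (k + 1) → Density P (k + 1) G) (σ : Seq D k → Lb → Seq D (k + 1))
    (ω : Seq D k → Lb → GaugeField P k G → GaugeField P (k + 1) G → ℝ) (hσ : ∀ s t, (σ s t).init = s)
    (hunit : ∀ (s : Seq D k) (U : GaugeField P k G), χk s U * ∑ t, χk1 (σ s t) (avg U) * ω s t U (avg U) = χk s U) :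
    IsStepUnity avg χk χk1 (resumWeights σ ω) := by
  intro s U
  have key : ∀ s' ∈ Finset.univ.filter (fun s' : Seq D (k + 1) => s'.init = s),
      χk1 s' (avg U) * resumWeights σ ω s' U (avg U)
        = ∑ t ∈ Finset.univ.filter (fun t : Lb => σ s t = s'), χk1 (σ s t) (avg U) * ω s t U (avg U) := by
    intro s' hs'
    have hs : s'.init = s := (Finset.mem_filter.1 hs').2
    rw [resumWeights, hs, Finset.mul_sum]
    refine Finset.sum_congr rfl (fun t ht => ?_)
    rw [(Finset.mem_filter.1 ht).2]
  have hsum : ∑ s' ∈ Finset.univ.filter (fun s' : Seq D (k + 1) => s'.init = s),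
      χk1 s' (avg U) * resumWeights σ ω s' U (avg U) = ∑ t, χk1 (σ s t) (avg U) * ω s t U (avg U) := by
    rw [Finset.sum_congr rfl key]
    exact Finset.sum_fiberwise_of_maps_to (fun t _ => by simp [hσ]) _
  rw [hsum]
  exact hunit s U

open Classical in
/-- **`Σ_t |ω s t| ≤ 1` ⇒ `|w| ≤ 1`** for the resummed step weights (print: the labels are mutually exclusive `{0,1}`-valued
products of characteristic functions). [cite: Balaban1988Convergent, (3.2)–(3.3) p.265, (3.16) p.268 (bookkeeping)] -/
theorem abs_resumWeights_le_one (σ : Seq D k → Lb → Seq D (k + 1))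
    (ω : Seq D k → Lb → GaugeField P k G → GaugeField P (k + 1) G → ℝ)
    (hω : ∀ s U V', ∑ t, |ω s t U V'| ≤ 1) (s' : Seq D (k + 1)) (U : GaugeField P k G) (V' : GaugeField P (k + 1) G) :
    |resumWeights σ ω s' U V'| ≤ 1 :=
  (Finset.abs_sum_le_sum_abs _ _).trans
    ((Finset.sum_le_sum_of_subset_of_nonneg (Finset.filter_subset _ _) (fun _ _ _ => abs_nonneg _)).trans (hω _ _ _))

open Classical in
/-- **Jointly measurable label weights ⇒ jointly measurable step weights** (the `measW` proviso). [cite: Balaban1988Convergent, (3.2)–(3.3) p.265 (bookkeeping)] -/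
theorem measurable_resumWeights [MeasurableSpace G] (σ : Seq D k → Lb → Seq D (k + 1))
    (ω : Seq D k → Lb → GaugeField P k G → GaugeField P (k + 1) G → ℝ)
    (hω : ∀ s t, Measurable (fun z : GaugeField P (k + 1) G × GaugeField P k G => ω s t z.2 z.1)) (s' : Seq D (k + 1)) :
    Measurable (fun z : GaugeField P (k + 1) G × GaugeField P k G => resumWeights σ ω s' z.2 z.1) := by
  unfold resumWeights
  exact Finset.measurable_sum _ (fun t _ => hω _ t)

end Resum

section ResumOfRecord

variable (ν : Stage7Numerics) (M : ℕ)

/-- **Step weights OF RECORD from labelled decompositions per run ∕ couplings ∕ step** (the shape a hand pinning `w` supplies: label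
types `Lb p g k`, index maps `σ p g k`, label weights `ω p g k`). [cite: Balaban1988Convergent, (3.2)–(3.3) p.265, (3.5) p.265, (3.16) p.268, (3.20) p.269] -/
def stepWeightsOfResum (Lb : B12.RunParams → (ℕ → ℝ) → ℕ → Type) [∀ p g k, Fintype (Lb p g k)]
    (σ : (p : B12.RunParams) → (g : ℕ → ℝ) → (k : ℕ) → SeqOfRecord F ν M g p.K k → Lb p g k → SeqOfRecord F ν M g p.K (k + 1))
    (ω : (p : B12.RunParams) → (g : ℕ → ℝ) → (k : ℕ) → SeqOfRecord F ν M g p.K k → Lb p g k →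
      GaugeField (F.P p.K) k (SU N) → GaugeField (F.P p.K) (k + 1) (SU N) → ℝ) :
    StepWeightsOfRecord F N ν M :=
  fun p g k => resumWeights (σ p g k) (ω p g k)

/-- The step weights of record from a labelled decomposition satisfy the unity law at `(p, g, k)` as soon as the labelled
decomposition resolves unity there (on the graph of the averaging of record, `χ_k`-weighted). [cite: Balaban1988Convergent, (3.2)–(3.3) p.265, (3.6)–(3.9) pp.265–266, (3.16) p.268] -/
theorem isStepUnity_stepWeightsOfResum (Lb : B12.RunParams → (ℕ → ℝ) → ℕ → Type) [∀ p g k, Fintype (Lb p g k)]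
    (σ : (p : B12.RunParams) → (g : ℕ → ℝ) → (k : ℕ) → SeqOfRecord F ν M g p.K k → Lb p g k → SeqOfRecord F ν M g p.K (k + 1))
    (ω : (p : B12.RunParams) → (g : ℕ → ℝ) → (k : ℕ) → SeqOfRecord F ν M g p.K k → Lb p g k →
      GaugeField (F.P p.K) k (SU N) → GaugeField (F.P p.K) (k + 1) (SU N) → ℝ)
    (p : B12.RunParams) (g : ℕ → ℝ) (k : ℕ) (hσ : ∀ s t, (σ p g k s t).init = s)
    (hunit : ∀ (s : SeqOfRecord F ν M g p.K k) (U : GaugeField (F.P p.K) k (SU N)),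
      chiSeqOfRecord F N ν M g p.K k s U
          * ∑ t, chiSeqOfRecord F N ν M g p.K (k + 1) (σ p g k s t) ((avOfRecord F N p.K k).avg U)
              * ω p g k s t U ((avOfRecord F N p.K k).avg U)
        = chiSeqOfRecord F N ν M g p.K k s U) :
    IsStepUnity (avOfRecord F N p.K k).avg (chiSeqOfRecord F N ν M g p.K k) (chiSeqOfRecord F N ν M g p.K (k + 1))
      (stepWeightsOfResum F N ν M Lb σ ω p g k) :=
  isStepUnity_resumWeights _ _ _ _ _ hσ hunit

end ResumOfRecord

end Literature.MathematicalPhysics.QuantumFieldTheory.Balaban1983to89.Node00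

end
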